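import Summits.NavierStokesRegularity.NavierStokesRegularity.Theorems.AxisymmetricExtremalityAxisymmetricKatoGlobalStubSeregin2020TypeIILemma22DriftCommutator
import Summits.NavierStokesRegularity.NavierStokesRegularity.Theorems.AxisymmetricExtremalityAxisymmetricKatoGlobalStubSeregin2020TypeIILemma22AxisMeasureTools
import HarnessLib

/-!
# Seregin 2020, Lemma 2.2 (after Nazarov–Uraltseva 2012, Lemma 4.2, (4.6)–(4.8)): preparations for
# the measure estimate

Helper toward the stub `stub_seregin2020TypeII` of the crux `AxisymmetricKatoGlobal` (= the named
fact `Literature.Analysis.FluidPDE.Seregin2020_axisymmetricSingularPoint_typeII`, G. Seregin,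
Anal. Math. Phys. 10 (2020) Paper 46 = arXiv:2006.04140, Thm 2.1), reduced in the tree to the
corrected Lemma 2.2 (`hWH′`). This file holds the budget-sized pieces of the proof of the measure
estimate (4.8) of N–U Lemma 4.2 for the class 𝒱 (piece L22-A of the cell's cut), so that the main
file `…Lemma22AxisMeasure` only strings them together:

* `slab_geometry`, `slab_integrability` — the slab `Q' = ]-R², -¾R²[ × B_R` (open, inside
  `Q(2R)`, volume `≤ 2R⁵`; the drift is `L¹ ∩ L³` and `ϱ⁻¹` is integrable on it);
* `slabIntegral_inv_cylRadius_thin_le` — `∫_{Q' ∩ {ϱ < θ²R}} ϱ⁻¹ ≤ (R²/4)·(C θ R²)`;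
* `setIntegral_affine_majorant` — `∫_A (c₁ + c₂‖U‖ + c₃ϱ⁻¹)` split into its three terms;
* `setIntegral_norm_cube_slab_le` — real form of the drift bound `∫∫_{Q'} ‖U‖³ ≤ (¾N + 1/16) R²`;
* `pointwise_majorant` — the pointwise bound behind (4.7): `Φ w₀ ≤ χ F`;
* `axis_constants`, `axis_measure_algebra` — the choice of `ϰ, δ` and the bookkeeping
  `(3π/16) kR³ ≤ Mk ∫_E F + ϰk ∫_{Q'} F ⟹ δ R⁵ ≤ |E|` ((4.7) ⟹ (4.8)).

No NS regularity statement is proved here; a printed lemma is being re-proved.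

## References

* A. I. Nazarov, N. N. Uraltseva, St. Petersburg Math. J. 23 (2012) 93–115 = arXiv:1011.1888,
  proof of Lemma 4.2, (4.6)–(4.8). [NazarovUraltseva2012]
* G. Seregin, Anal. Math. Phys. 10 (2020), Paper 46 = arXiv:2006.04140, Lemma 2.2. [Seregin2020]
-/

-- the problem directory repeats the summit name (D-0017); core's `dupNamespace` linter fires
set_option linter.dupNamespace false

noncomputable section

open MeasureTheory Set Function Filter Topology TopologicalSpace Metric
open scoped NNReal ENNReal

namespace Summit.NavierStokesRegularity.NavierStokesRegularity.Theorems.AxisymmetricKatoGlobal.EulerScaling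

open Literature.Analysis.FluidPDE

/-! ### The slab `Q' = ]-R², -¾R²[ × B_R` -/

/-- Geometry of the slab `Q' = ]-R², -¾R²[ × B_R` of N–U (4.6)–(4.8): it is open, contained in the
compact slab `[-R², -¾R²] × B̄_R ⊆ {t < 0}`, in `]-R², 0[ × B(2R)` and in `Q(2R)`; it has finite
volume `≤ 2R⁵`, and it contains the support box of the test function of (4.6). [folklore] -/
theorem slab_geometry {R : ℝ} (hR : 0 < R) :
    IsOpen (Ioo (-R ^ 2) (-(3 / 4) * R ^ 2) ×ˢ ball (0 : EuclideanSpace ℝ (Fin 3)) R) ∧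
    Ioo (-R ^ 2) (-(3 / 4) * R ^ 2) ×ˢ ball (0 : EuclideanSpace ℝ (Fin 3)) R ⊆
      Icc (-R ^ 2) (-(3 / 4) * R ^ 2) ×ˢ closedBall (0 : EuclideanSpace ℝ (Fin 3)) R ∧
    Icc (-R ^ 2) (-(3 / 4) * R ^ 2) ×ˢ closedBall (0 : EuclideanSpace ℝ (Fin 3)) R ⊆
      {w : ℝ × EuclideanSpace ℝ (Fin 3) | w.1 < 0} ∧
    (∀ w ∈ Ioo (-R ^ 2) (-(3 / 4) * R ^ 2) ×ˢ ball (0 : EuclideanSpace ℝ (Fin 3)) R,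
      w.1 ∈ Ioo (-R ^ 2) 0 ∧ w.2 ∈ ball (0 : EuclideanSpace ℝ (Fin 3)) (2 * R)) ∧
    Ioo (-R ^ 2) (-(3 / 4) * R ^ 2) ×ˢ ball (0 : EuclideanSpace ℝ (Fin 3)) R ⊆
      parabolicCylinder (2 * R) (0 : ℝ × EuclideanSpace ℝ (Fin 3)) ∧
    volume (Ioo (-R ^ 2) (-(3 / 4) * R ^ 2) ×ˢ ball (0 : EuclideanSpace ℝ (Fin 3)) R) < ∞ ∧
    volume.real (Ioo (-R ^ 2) (-(3 / 4) * R ^ 2) ×ˢ ball (0 : EuclideanSpace ℝ (Fin 3)) R) ≤ 2 * R ^ 5 ∧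
    Icc (-(15 * R ^ 2 / 16)) (-(13 * R ^ 2 / 16)) ×ˢ closedBall (0 : EuclideanSpace ℝ (Fin 3)) (3 * R / 4) ⊆
      Ioo (-R ^ 2) (-(3 / 4) * R ^ 2) ×ˢ ball (0 : EuclideanSpace ℝ (Fin 3)) R := by
  have hR2 : 0 < R ^ 2 := pow_pos hR 2
  have hvol : volume (Ioo (-R ^ 2) (-(3 / 4) * R ^ 2) ×ˢ ball (0 : EuclideanSpace ℝ (Fin 3)) R) =
      ENNReal.ofReal (Real.pi / 3 * R ^ 5) := by
    rw [Measure.volume_eq_prod, Measure.prod_prod, Real.volume_Ioo, EuclideanSpace.volume_ball_fin_three,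
      ← ENNReal.ofReal_pow hR.le, ← ENNReal.ofReal_mul (by positivity), ← ENNReal.ofReal_mul (by linarith)]
    congr 1; ring
  refine ⟨isOpen_Ioo.prod isOpen_ball, prod_mono Ioo_subset_Icc_self ball_subset_closedBall, fun w hw => ?_,
    fun w hw => ?_, fun w hw => ?_, ?_, ?_, ?_⟩
  · have h := hw.1; rw [mem_Icc] at h; show w.1 < 0; linarith [h.2]
  · have h1 := hw.1; rw [mem_Ioo] at h1
    exact ⟨⟨h1.1, by linarith [h1.2]⟩, ball_subset_ball (by linarith) hw.2⟩
  · rw [mem_parabolicCylinder]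
    have h1 := hw.1; rw [mem_Ioo] at h1
    have h2 : dist w.2 (0 : EuclideanSpace ℝ (Fin 3)) < R := mem_ball.1 hw.2
    refine ⟨⟨?_, ?_⟩, ?_⟩
    · show (0 : ℝ) - (2 * R) ^ 2 < w.1
      rw [show (0 : ℝ) - (2 * R) ^ 2 = -R ^ 2 - 3 * R ^ 2 by ring]
      linarith [h1.1]
    · show w.1 < (0 : ℝ)
      linarith [h1.2]
    · show dist w.2 (0 : EuclideanSpace ℝ (Fin 3)) < 2 * R
      linarith
  · rw [hvol]; exact ENNReal.ofReal_lt_top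
  · rw [measureReal_def, hvol, ENNReal.toReal_ofReal (by positivity)]
    have h4 := mul_le_mul_of_nonneg_right Real.pi_le_four (pow_pos hR 5).le
    rw [div_mul_eq_mul_div, div_le_iff₀ (by norm_num : (0:ℝ) < 3)]
    linarith [pow_pos hR 5]
  · rintro ⟨t, x⟩ ⟨ht, hx⟩
    rw [mem_Icc] at ht
    rw [mem_closedBall, dist_zero_right] at hx
    refine ⟨⟨by linarith [ht.1], by linarith [ht.2]⟩, ?_⟩
    rw [mem_ball, dist_zero_right]; linarith

/-- Integrability on the slab `Q' = ]-R², -¾R²[ × B_R` of a drift `U` continuous off the axis on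
`{t < 0}` and locally `L³` on the cylinders `Q(a)`: `U` is a.e.-strongly measurable on `Q'`,
`‖U‖³` and `‖U‖` are integrable on `Q'`, and so is `ϱ⁻¹`. [folklore] -/
theorem slab_integrability {U : ℝ → EuclideanSpace ℝ (Fin 3) → EuclideanSpace ℝ (Fin 3)} {R : ℝ} (hR : 0 < R)
    (hUc : ContinuousOn (uncurry U) {z : ℝ × EuclideanSpace ℝ (Fin 3) | z.1 < 0 ∧ cylRadius z.2 ≠ 0})
    (hU3loc : ∀ a : ℝ, 0 < a →
      ∫⁻ z in parabolicCylinder a (0 : ℝ × EuclideanSpace ℝ (Fin 3)), ‖U z.1 z.2‖ₑ ^ (3 : ℕ) < ∞) :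
    AEStronglyMeasurable (uncurry U)
      (volume.restrict (Ioo (-R ^ 2) (-(3 / 4) * R ^ 2) ×ˢ ball (0 : EuclideanSpace ℝ (Fin 3)) R)) ∧
    IntegrableOn (fun w : ℝ × EuclideanSpace ℝ (Fin 3) => ‖U w.1 w.2‖ ^ 3)
      (Ioo (-R ^ 2) (-(3 / 4) * R ^ 2) ×ˢ ball (0 : EuclideanSpace ℝ (Fin 3)) R) ∧
    IntegrableOn (fun w : ℝ × EuclideanSpace ℝ (Fin 3) => ‖U w.1 w.2‖)
      (Ioo (-R ^ 2) (-(3 / 4) * R ^ 2) ×ˢ ball (0 : EuclideanSpace ℝ (Fin 3)) R) ∧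
    IntegrableOn (fun w : ℝ × EuclideanSpace ℝ (Fin 3) => (cylRadius w.2)⁻¹)
      (Ioo (-R ^ 2) (-(3 / 4) * R ^ 2) ×ˢ ball (0 : EuclideanSpace ℝ (Fin 3)) R) := by
  obtain ⟨-, hQ'K', hK'neg, -, hQ'cyl, hQ'fin, -⟩ := slab_geometry hR
  have hK'c : IsCompact (Icc (-R ^ 2) (-(3 / 4) * R ^ 2) ×ˢ closedBall (0 : EuclideanSpace ℝ (Fin 3)) R) :=
    isCompact_Icc.prod (isCompact_closedBall _ _)
  have hK'm := hK'c.isClosed.measurableSet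
  have hUmK := aestronglyMeasurable_indicator_of_continuousOn_offAxis
    (isOpen_lt continuous_fst continuous_const) hK'c hK'neg hUc
  have hUmQ : AEStronglyMeasurable (uncurry U)
      (volume.restrict (Ioo (-R ^ 2) (-(3 / 4) * R ^ 2) ×ˢ ball (0 : EuclideanSpace ℝ (Fin 3)) R)) :=
    ((aestronglyMeasurable_indicator_iff hK'm).1 hUmK).mono_measure (Measure.restrict_mono hQ'K' le_rfl)
  have hU3Q : IntegrableOn (fun w : ℝ × EuclideanSpace ℝ (Fin 3) => ‖U w.1 w.2‖ ^ 3)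
      (Ioo (-R ^ 2) (-(3 / 4) * R ^ 2) ×ˢ ball (0 : EuclideanSpace ℝ (Fin 3)) R) := by
    refine ⟨hUmQ.norm.pow 3, ?_⟩
    rw [HasFiniteIntegral]
    refine lt_of_le_of_lt (lintegral_mono fun w => ?_)
      (lt_of_le_of_lt (lintegral_mono_set hQ'cyl) (hU3loc (2 * R) (mul_pos two_pos hR)))
    rw [Real.enorm_eq_ofReal (pow_nonneg (norm_nonneg _) 3), ← ofReal_norm, ← ENNReal.ofReal_pow (norm_nonneg _)]
  have hU1Q : IntegrableOn (fun w : ℝ × EuclideanSpace ℝ (Fin 3) => ‖U w.1 w.2‖)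
      (Ioo (-R ^ 2) (-(3 / 4) * R ^ 2) ×ˢ ball (0 : EuclideanSpace ℝ (Fin 3)) R) := by
    have h13 : IntegrableOn (fun w : ℝ × EuclideanSpace ℝ (Fin 3) => ‖U w.1 w.2‖ ^ 3 + 1)
        (Ioo (-R ^ 2) (-(3 / 4) * R ^ 2) ×ˢ ball (0 : EuclideanSpace ℝ (Fin 3)) R) :=
      hU3Q.add (integrableOn_const (C := (1 : ℝ)) hQ'fin.ne)
    refine Integrable.mono' h13 hUmQ.norm (Eventually.of_forall fun w => ?_)
    have h := le_cube_div_sq_add (norm_nonneg (U w.1 w.2)) one_pos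
    rw [one_pow, div_one] at h
    show ‖‖U w.1 w.2‖‖ ≤ ‖U w.1 w.2‖ ^ 3 + 1
    rw [norm_norm]; exact h
  exact ⟨hUmQ, hU3Q, hU1Q, (integrableOn_inv_cylRadius_snd hK'c).mono_set hQ'K'⟩

/-- The axis-singular weight on a thin tube of the slab: `∫_{(]a,b[ × B_R) ∩ {ϱ < θ²R}} ϱ⁻¹ ≤
(b - a)·(C θ R²)`, from `lintegral_inv_cylRadius_thin_le` slice-wise (Fubini). [folklore] -/
theorem slabIntegral_inv_cylRadius_thin_le {C : ℝ≥0}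
    (hC : ∀ (x₀ : EuclideanSpace ℝ (Fin 3)) (r : ℝ), 0 < r →
      ∫⁻ x in ball x₀ r, ENNReal.ofReal (cylRadius x ^ (-(3 / 2 : ℝ))) ≤ (C : ℝ≥0∞) * ENNReal.ofReal (r ^ (3 - 3 / 2 : ℝ)))
    {R : ℝ} (hR : 0 < R) {a b : ℝ} (hab : a ≤ b) {θ : ℝ} (hθ : 0 < θ) :
    ∫ w in (Ioo a b ×ˢ ball (0 : EuclideanSpace ℝ (Fin 3)) R) ∩ {w | cylRadius w.2 < θ ^ 2 * R}, (cylRadius w.2)⁻¹ ≤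
      (b - a) * ((C : ℝ) * θ * R ^ 2) := by
  have eset : (Ioo a b ×ˢ ball (0 : EuclideanSpace ℝ (Fin 3)) R) ∩
      {w : ℝ × EuclideanSpace ℝ (Fin 3) | cylRadius w.2 < θ ^ 2 * R} =
      Ioo a b ×ˢ (ball (0 : EuclideanSpace ℝ (Fin 3)) R ∩ {x | cylRadius x < θ ^ 2 * R}) := by
    ext w; simp only [mem_inter_iff, mem_prod, mem_setOf_eq]; tauto
  rw [eset, Measure.volume_eq_prod]
  have h := setIntegral_prod_mul (μ := (volume : Measure ℝ)) (ν := (volume : Measure (EuclideanSpace ℝ (Fin 3))))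
    (fun _ : ℝ => (1 : ℝ)) (fun x : EuclideanSpace ℝ (Fin 3) => (cylRadius x)⁻¹) (Ioo a b)
    (ball (0 : EuclideanSpace ℝ (Fin 3)) R ∩ {x | cylRadius x < θ ^ 2 * R})
  simp only [one_mul, setIntegral_const, smul_eq_mul, mul_one, Real.volume_real_Ioo_of_le hab] at h
  rw [h]
  refine mul_le_mul_of_nonneg_left ?_ (by linarith)
  rw [integral_eq_lintegral_of_nonneg_ae (Eventually.of_forall fun x => inv_nonneg.2 (cylRadius_nonneg _))
    continuous_cylRadius.measurable.inv.aestronglyMeasurable]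
  have h2 := ENNReal.toReal_mono ENNReal.ofReal_ne_top (lintegral_inv_cylRadius_thin_le hC hR hθ (0 : EuclideanSpace ℝ (Fin 3)))
  rwa [ENNReal.toReal_ofReal (mul_nonneg (mul_nonneg (NNReal.coe_nonneg C) hθ.le) (sq_nonneg R))] at h2

/-- Splitting `∫_A (c₁ + c₂‖U‖ + c₃ ϱ⁻¹)` into its three terms on a set of finite measure on which
`‖U‖` and `ϱ⁻¹` are integrable. [folklore] -/
theorem setIntegral_affine_majorant {U : ℝ → EuclideanSpace ℝ (Fin 3) → EuclideanSpace ℝ (Fin 3)}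
    {A : Set (ℝ × EuclideanSpace ℝ (Fin 3))} (hAfin : volume A < ∞)
    (hU1 : IntegrableOn (fun w : ℝ × EuclideanSpace ℝ (Fin 3) => ‖U w.1 w.2‖) A)
    (hρ : IntegrableOn (fun w : ℝ × EuclideanSpace ℝ (Fin 3) => (cylRadius w.2)⁻¹) A) (c₁ c₂ c₃ : ℝ) :
    ∫ w in A, (c₁ + c₂ * ‖U w.1 w.2‖ + c₃ * (cylRadius w.2)⁻¹) =
      c₁ * volume.real A + c₂ * (∫ w in A, ‖U w.1 w.2‖) + c₃ * ∫ w in A, (cylRadius w.2)⁻¹ := by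
  have i1 : IntegrableOn (fun _ : ℝ × EuclideanSpace ℝ (Fin 3) => c₁) A := integrableOn_const (C := c₁) hAfin.ne
  have i2 : IntegrableOn (fun w : ℝ × EuclideanSpace ℝ (Fin 3) => c₂ * ‖U w.1 w.2‖) A := hU1.const_mul _
  have i3 : IntegrableOn (fun w : ℝ × EuclideanSpace ℝ (Fin 3) => c₃ * (cylRadius w.2)⁻¹) A := hρ.const_mul _
  have i12 : IntegrableOn (fun w : ℝ × EuclideanSpace ℝ (Fin 3) => c₁ + c₂ * ‖U w.1 w.2‖) A := i1.add i2
  rw [integral_add i12 i3, integral_add i1 i2, integral_const_mul, integral_const_mul, setIntegral_const, smul_eq_mul,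
    mul_comm (volume.real A)]

/-- Real form of the drift bound on the slab: `∫∫_{]-R²,-¾R²[ × B_R} ‖U‖³ ≤ (¾ N + 1/16) R²`
(`lintegral_cube_slab_le`). [cite: NazarovUraltseva2012, Lemma 4.2, the quantity 𝒩̂] -/
theorem setIntegral_norm_cube_slab_le {R : ℝ} (hR : 0 < R) {N : ℝ≥0}
    {U : ℝ → EuclideanSpace ℝ (Fin 3) → EuclideanSpace ℝ (Fin 3)}
    (hUm : AEStronglyMeasurable (uncurry U)
      (volume.restrict (Ioo (-R ^ 2) (-(3 / 4) * R ^ 2) ×ˢ ball (0 : EuclideanSpace ℝ (Fin 3)) R)))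
    (hN : ∫⁻ s in Ioo (-R ^ 2) 0, (∫⁻ y in ball (0 : EuclideanSpace ℝ (Fin 3)) (2 * R), ‖U s y‖ₑ ^ (3 : ℕ)) ^ (4 / 3 : ℝ) ≤
      (N : ℝ≥0∞) * ENNReal.ofReal R ^ 2) :
    ∫ w in Ioo (-R ^ 2) (-(3 / 4) * R ^ 2) ×ˢ ball (0 : EuclideanSpace ℝ (Fin 3)) R, ‖U w.1 w.2‖ ^ 3 ≤
      (3 / 4 * (N : ℝ) + 1 / 16) * R ^ 2 := by
  have hm : AEStronglyMeasurable (fun w : ℝ × EuclideanSpace ℝ (Fin 3) => ‖U w.1 w.2‖ ^ 3)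
      (volume.restrict (Ioo (-R ^ 2) (-(3 / 4) * R ^ 2) ×ˢ ball (0 : EuclideanSpace ℝ (Fin 3)) R)) := hUm.norm.pow 3
  rw [integral_eq_lintegral_of_nonneg_ae (Eventually.of_forall fun w => pow_nonneg (norm_nonneg _) 3) hm]
  have h1 : ∫⁻ w in Ioo (-R ^ 2) (-(3 / 4) * R ^ 2) ×ˢ ball (0 : EuclideanSpace ℝ (Fin 3)) R, ENNReal.ofReal (‖U w.1 w.2‖ ^ 3) =
      ∫⁻ w in Ioo (-R ^ 2) (-(3 / 4) * R ^ 2) ×ˢ ball (0 : EuclideanSpace ℝ (Fin 3)) R, ‖U w.1 w.2‖ₑ ^ (3 : ℕ) :=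
    lintegral_congr_ae (Eventually.of_forall fun w => by beta_reduce; rw [ENNReal.ofReal_pow (norm_nonneg _), ofReal_norm])
  rw [h1]
  have h2 := lintegral_cube_slab_le hR hUm hN
  have h3 : (3 / 4 : ℝ≥0∞) * ((N : ℝ≥0∞) * ENNReal.ofReal R ^ 2) + ENNReal.ofReal (R ^ 2 / 16) =
      ENNReal.ofReal ((3 / 4 * (N : ℝ) + 1 / 16) * R ^ 2) := by
    have e34 : (3 / 4 : ℝ≥0∞) = ENNReal.ofReal (3 / 4) := by
      rw [ENNReal.ofReal_div_of_pos (by norm_num : (0:ℝ) < 4)]; simp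
    rw [e34, ← ENNReal.ofReal_coe_nnreal, ← ENNReal.ofReal_pow hR.le, ← ENNReal.ofReal_mul (NNReal.coe_nonneg N),
      ← ENNReal.ofReal_mul (by norm_num : (0:ℝ) ≤ 3 / 4),
      ← ENNReal.ofReal_add (mul_nonneg (by norm_num) (mul_nonneg (NNReal.coe_nonneg N) (sq_nonneg R)))
        (div_nonneg (sq_nonneg R) (by norm_num))]
    congr 1; ring
  rw [h3] at h2
  have h4 := ENNReal.toReal_mono ENNReal.ofReal_ne_top h2
  rwa [ENNReal.toReal_ofReal (mul_nonneg (by positivity) (sq_nonneg R))] at h4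

/-! ### Pointwise majorant and the bookkeeping (4.7) ⟹ (4.8) -/

/-- The pointwise bound behind N–U (4.7): with `|∂ₜη₀| ≤ C₀/R²`, `‖Dη₀‖ ≤ C₀/R`, `|Δη₀| ≤ C₀/R²`
and `0 ≤ Φ ≤ χ`, `Φ (|∂ₜη₀| + ‖U‖‖Dη₀‖ + 2ϱ⁻¹‖Dη₀‖ + |Δη₀|) ≤ χ (2C₀/R² + (C₀/R)‖U‖ + (2C₀/R)ϱ⁻¹)`.
[cite: NazarovUraltseva2012, proof of Lemma 4.2, (4.6)–(4.7)] -/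
theorem pointwise_majorant {Φ₀ χ₀ a b c u ρi C₀ R : ℝ} (hΦ₀ : 0 ≤ Φ₀) (hΦχ : Φ₀ ≤ χ₀)
    (hu : 0 ≤ u) (hρi : 0 ≤ ρi) (ha₀ : 0 ≤ a) (hb₀ : 0 ≤ b) (hc₀ : 0 ≤ c)
    (ha : a ≤ C₀ / R ^ 2) (hb : b ≤ C₀ / R) (hc : c ≤ C₀ / R ^ 2) :
    Φ₀ * (a + u * b + 2 * ρi * b + c) ≤ χ₀ * (2 * C₀ / R ^ 2 + C₀ / R * u + 2 * C₀ / R * ρi) := by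
  have hw₀ : a + u * b + 2 * ρi * b + c ≤ 2 * C₀ / R ^ 2 + C₀ / R * u + 2 * C₀ / R * ρi := by
    have h1 := mul_le_mul_of_nonneg_left hb hu
    have h2 := mul_le_mul_of_nonneg_left hb (mul_nonneg two_pos.le hρi)
    calc _ ≤ C₀ / R ^ 2 + u * (C₀ / R) + 2 * ρi * (C₀ / R) + C₀ / R ^ 2 := by linarith
      _ = _ := by ring
  exact mul_le_mul hΦχ hw₀ (by positivity) (hΦ₀.trans hΦχ)

/-- **The constants of N–U (4.8)** for the class 𝒱 at level ratio `M` and drift bound `N`: given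
the test-function constant `C₀` and the axis-weight constant `C` (`∫_{B_r} ϱ^{-3/2} ≤ C r^{3/2}`),
a choice of `M' = max M 1`, `cN = ¾N + 1/16`, the truncation levels `ℓ, θ`, the budget `D`, the
level ratio `ϰ ∈ ]0,1]`, `Γ` and `δ > 0` with the three budget inequalities used in
`axis_measure_algebra`. [cite: NazarovUraltseva2012, proof of Lemma 4.2, "for sufficiently small ϰ"] -/
theorem axis_constants (M : ℝ) (N C : ℝ≥0) {C₀ : ℝ} (hC₀0 : 0 ≤ C₀) :
    ∃ M' cN ℓ θ D ϰ Γ δ : ℝ, M ≤ M' ∧ 1 ≤ M' ∧ cN = 3 / 4 * (N : ℝ) + 1 / 16 ∧ 0 < ℓ ∧ 0 < θ ∧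
      0 < ϰ ∧ ϰ ≤ 1 ∧ 0 < δ ∧ Γ = 2 * C₀ + C₀ * ℓ + 2 * C₀ * (θ ^ 2)⁻¹ ∧
      δ = 3 * Real.pi / 32 / (M' * Γ + 1) ∧ M' * C₀ * cN ≤ Real.pi / 32 * ℓ ^ 2 ∧
      16 * M' * C₀ * (C : ℝ) * θ ≤ Real.pi ∧ ϰ * D ≤ Real.pi / 32 ∧
      10 * C₀ + C₀ * cN + C₀ * (C : ℝ) / 2 ≤ D := by
  obtain ⟨M', hM'⟩ : ∃ M' : ℝ, M' = max M 1 := ⟨_, rfl⟩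
  have hM'1 : 1 ≤ M' := by rw [hM']; exact le_max_right _ _
  have hM'0 : 0 < M' := lt_of_lt_of_le one_pos hM'1
  obtain ⟨cN, hcN⟩ : ∃ cN : ℝ, cN = 3 / 4 * (N : ℝ) + 1 / 16 := ⟨_, rfl⟩
  have hcN0 : 0 ≤ cN := by rw [hcN]; positivity
  obtain ⟨ℓ, hℓ⟩ : ∃ ℓ : ℝ, ℓ = Real.sqrt (32 * M' * C₀ * cN / Real.pi) + 1 := ⟨_, rfl⟩
  have hℓ0 : 0 < ℓ := by rw [hℓ]; positivity
  obtain ⟨θ, hθ⟩ : ∃ θ : ℝ, θ = Real.pi / (16 * M' * C₀ * C + Real.pi) := ⟨_, rfl⟩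
  have hθ0 : 0 < θ := by rw [hθ]; positivity
  obtain ⟨D, hD⟩ : ∃ D : ℝ, D = 4 * C₀ + C₀ * (cN + 2) + 2 * C₀ * ((C : ℝ) / 4 + 2) := ⟨_, rfl⟩
  have hD0 : 0 ≤ D := by rw [hD]; positivity
  obtain ⟨ϰ, hϰ⟩ : ∃ ϰ : ℝ, ϰ = min 1 (Real.pi / (32 * (D + 1))) := ⟨_, rfl⟩
  have hϰ0 : 0 < ϰ := by rw [hϰ]; exact lt_min one_pos (by positivity)
  have hϰ1 : ϰ ≤ 1 := by rw [hϰ]; exact min_le_left _ _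
  obtain ⟨Γ, hΓ⟩ : ∃ Γ : ℝ, Γ = 2 * C₀ + C₀ * ℓ + 2 * C₀ * (θ ^ 2)⁻¹ := ⟨_, rfl⟩
  have hΓ0 : 0 ≤ Γ := by rw [hΓ]; positivity
  obtain ⟨δ, hδ⟩ : ∃ δ : ℝ, δ = (3 * Real.pi / 32) / (M' * Γ + 1) := ⟨_, rfl⟩
  have hδ0 : 0 < δ := by rw [hδ]; positivity
  have hπ0 : 0 < Real.pi := Real.pi_pos
  have hP1 : M' * C₀ * cN ≤ Real.pi / 32 * ℓ ^ 2 := by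
    have hs : Real.sqrt (32 * M' * C₀ * cN / Real.pi) ^ 2 = 32 * M' * C₀ * cN / Real.pi :=
      Real.sq_sqrt (by positivity)
    have hle : Real.sqrt (32 * M' * C₀ * cN / Real.pi) ^ 2 ≤ ℓ ^ 2 := by
      rw [hℓ]; nlinarith [Real.sqrt_nonneg (32 * M' * C₀ * cN / Real.pi)]
    rw [hs, div_le_iff₀ hπ0] at hle
    nlinarith
  have hP2 : 16 * M' * C₀ * (C : ℝ) * θ ≤ Real.pi := by
    rw [hθ, mul_div_assoc', div_le_iff₀ (by positivity)]
    nlinarith [mul_nonneg (mul_nonneg (mul_nonneg (by norm_num : (0:ℝ) ≤ 16) hM'0.le) hC₀0) (NNReal.coe_nonneg C)]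
  have hP3 : ϰ * D ≤ Real.pi / 32 := by
    have h1 : ϰ ≤ Real.pi / (32 * (D + 1)) := by rw [hϰ]; exact min_le_right _ _
    have h2 : ϰ * (D + 1) ≤ Real.pi / 32 := by
      rw [le_div_iff₀ (by positivity)] at h1
      rw [le_div_iff₀ (by norm_num)]
      nlinarith
    nlinarith [mul_nonneg hϰ0.le (show (0:ℝ) ≤ 1 from zero_le_one)]
  have hD' : 10 * C₀ + C₀ * cN + C₀ * (C : ℝ) / 2 ≤ D := by rw [hD]; apply le_of_eq; ring
  exact ⟨M', cN, ℓ, θ, D, ϰ, Γ, δ, by rw [hM']; exact le_max_left _ _, hM'1, hcN, hℓ0, hθ0, hϰ0, hϰ1, hδ0, hΓ, hδ,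
    hP1, hP2, hP3, hD'⟩

/-- **The bookkeeping (4.7) ⟹ (4.8) of N–U Lemma 4.2** (pure real arithmetic): from the tested
inequality `(3π/16) kR³ ≤ Mk (2C₀/R² V + C₀/R ∫_E‖U‖ + 2C₀/R ∫_E ϱ⁻¹) + ϰk (same on Q')`, the
truncation bounds for `∫‖U‖` (levels `ℓ/R`, `R⁻¹`) and `∫ϱ⁻¹` (tubes `θ²R`, `R`), the drift bound
`Λ ≤ cN R²`, `|Q'| ≤ 2R⁵` and the budget inequalities of `axis_constants`, conclude `δ R⁵ ≤ V = |E|`.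
[cite: NazarovUraltseva2012, proof of Lemma 4.2, (4.7)–(4.8)] -/
theorem axis_measure_algebra {M M' C₀ C cN ℓ θ D ϰ Γ δ k R V vQ IUE IUQ IρE IρQ Λ TE TQ : ℝ}
    (hM : 1 ≤ M) (hMM' : M ≤ M') (hC₀0 : 0 ≤ C₀) (hC : 0 ≤ C) (hcN0 : 0 ≤ cN) (hℓ0 : 0 < ℓ) (hθ0 : 0 < θ)
    (hϰ0 : 0 < ϰ) (hk : 0 < k) (hR : 0 < R) (hV0 : 0 ≤ V) (hvQ : vQ ≤ 2 * R ^ 5)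
    (hΓ : Γ = 2 * C₀ + C₀ * ℓ + 2 * C₀ * (θ ^ 2)⁻¹) (hδ : δ = 3 * Real.pi / 32 / (M' * Γ + 1))
    (hP1 : M' * C₀ * cN ≤ Real.pi / 32 * ℓ ^ 2) (hP2 : 16 * M' * C₀ * C * θ ≤ Real.pi) (hP3 : ϰ * D ≤ Real.pi / 32)
    (hD' : 10 * C₀ + C₀ * cN + C₀ * C / 2 ≤ D) (hΛ : Λ ≤ cN * R ^ 2)
    (hUE : IUE ≤ (ℓ / R)⁻¹ ^ 2 * Λ + ℓ / R * V) (hUQ : IUQ ≤ (R⁻¹)⁻¹ ^ 2 * Λ + R⁻¹ * vQ)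
    (hTE : TE ≤ R ^ 2 / 4 * (C * θ * R ^ 2)) (hTQ : TQ ≤ R ^ 2 / 4 * (C * 1 * R ^ 2))
    (hρE : IρE ≤ TE + (θ ^ 2 * R)⁻¹ * V) (hρQ : IρQ ≤ TQ + (1 ^ 2 * R)⁻¹ * vQ)
    (hchain : 3 * Real.pi / 16 * (k * R ^ 3) ≤
      M * k * (2 * C₀ / R ^ 2 * V + C₀ / R * IUE + 2 * C₀ / R * IρE) +
        ϰ * k * (2 * C₀ / R ^ 2 * vQ + C₀ / R * IUQ + 2 * C₀ / R * IρQ)) :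
    δ * R ^ 5 ≤ V := by
  have hX : 0 < k * R ^ 3 := mul_pos hk (pow_pos hR 3)
  have hMk : 0 ≤ M * k := mul_nonneg (by linarith) hk.le
  have hϰk : 0 ≤ ϰ * k := mul_nonneg hϰ0.le hk.le
  have hΓ0 : 0 ≤ Γ := by rw [hΓ]; positivity
  have hM'0 : 0 < M' := by linarith
  have hC₀R : 0 ≤ C₀ / R := div_nonneg hC₀0 hR.le
  have h2C : 0 ≤ 2 * C₀ / R := div_nonneg (mul_nonneg two_pos.le hC₀0) hR.le
  have hUE' : C₀ / R * IUE ≤ C₀ / R * ((ℓ / R)⁻¹ ^ 2 * (cN * R ^ 2) + ℓ / R * V) := by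
    refine mul_le_mul_of_nonneg_left (hUE.trans ?_) hC₀R
    have := mul_le_mul_of_nonneg_left hΛ (sq_nonneg (ℓ / R)⁻¹)
    linarith
  have hUQ' : C₀ / R * IUQ ≤ C₀ / R * ((R⁻¹)⁻¹ ^ 2 * (cN * R ^ 2) + R⁻¹ * vQ) := by
    refine mul_le_mul_of_nonneg_left (hUQ.trans ?_) hC₀R
    have := mul_le_mul_of_nonneg_left hΛ (sq_nonneg (R⁻¹)⁻¹)
    linarith
  have hρE' : 2 * C₀ / R * IρE ≤ 2 * C₀ / R * (R ^ 2 / 4 * (C * θ * R ^ 2) + (θ ^ 2 * R)⁻¹ * V) :=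
    mul_le_mul_of_nonneg_left (hρE.trans (by linarith)) h2C
  have hρQ' : 2 * C₀ / R * IρQ ≤ 2 * C₀ / R * (R ^ 2 / 4 * (C * 1 * R ^ 2) + (1 ^ 2 * R)⁻¹ * vQ) :=
    mul_le_mul_of_nonneg_left (hρQ.trans (by linarith)) h2C
  have hE_br : M * k * (2 * C₀ / R ^ 2 * V + C₀ / R * IUE + 2 * C₀ / R * IρE) ≤
      M * k * (2 * C₀ / R ^ 2 * V + C₀ / R * ((ℓ / R)⁻¹ ^ 2 * (cN * R ^ 2) + ℓ / R * V) +
        2 * C₀ / R * (R ^ 2 / 4 * (C * θ * R ^ 2) + (θ ^ 2 * R)⁻¹ * V)) :=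
    mul_le_mul_of_nonneg_left (by linarith) hMk
  have hQ_br : ϰ * k * (2 * C₀ / R ^ 2 * vQ + C₀ / R * IUQ + 2 * C₀ / R * IρQ) ≤
      ϰ * k * (2 * C₀ / R ^ 2 * vQ + C₀ / R * ((R⁻¹)⁻¹ ^ 2 * (cN * R ^ 2) + R⁻¹ * vQ) +
        2 * C₀ / R * (R ^ 2 / 4 * (C * 1 * R ^ 2) + (1 ^ 2 * R)⁻¹ * vQ)) :=
    mul_le_mul_of_nonneg_left (by linarith) hϰk
  have hR0 : R ≠ 0 := hR.ne'
  have hℓ0' : ℓ ≠ 0 := hℓ0.ne'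
  have hθ0' : θ ≠ 0 := hθ0.ne'
  have eE : M * k * (2 * C₀ / R ^ 2 * V + C₀ / R * ((ℓ / R)⁻¹ ^ 2 * (cN * R ^ 2) + ℓ / R * V) +
        2 * C₀ / R * (R ^ 2 / 4 * (C * θ * R ^ 2) + (θ ^ 2 * R)⁻¹ * V)) =
      M * Γ * V * k / R ^ 2 + (M * C₀ * cN / ℓ ^ 2) * (k * R ^ 3) + (M * C₀ * C * θ / 2) * (k * R ^ 3) := by
    rw [hΓ]; field_simp; ring
  have eQ : ϰ * k * (2 * C₀ / R ^ 2 * vQ + C₀ / R * ((R⁻¹)⁻¹ ^ 2 * (cN * R ^ 2) + R⁻¹ * vQ) +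
        2 * C₀ / R * (R ^ 2 / 4 * (C * 1 * R ^ 2) + (1 ^ 2 * R)⁻¹ * vQ)) =
      ϰ * k * ((5 * C₀ / R ^ 2) * vQ + (C₀ * cN + C₀ * C / 2) * R ^ 3) := by
    field_simp; ring
  have hB1 : (M * C₀ * cN / ℓ ^ 2) * (k * R ^ 3) ≤ Real.pi / 32 * (k * R ^ 3) := by
    refine mul_le_mul_of_nonneg_right ?_ hX.le
    rw [div_le_iff₀ (pow_pos hℓ0 2)]
    have h := mul_le_mul_of_nonneg_right hMM' (mul_nonneg hC₀0 hcN0)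
    calc M * C₀ * cN = M * (C₀ * cN) := by ring
      _ ≤ M' * (C₀ * cN) := h
      _ = M' * C₀ * cN := by ring
      _ ≤ Real.pi / 32 * ℓ ^ 2 := hP1
  have hB2 : (M * C₀ * C * θ / 2) * (k * R ^ 3) ≤ Real.pi / 32 * (k * R ^ 3) := by
    refine mul_le_mul_of_nonneg_right ?_ hX.le
    have h := mul_le_mul_of_nonneg_right hMM' (mul_nonneg (mul_nonneg hC₀0 hC) hθ0.le)
    calc M * C₀ * C * θ / 2 = M * (C₀ * C * θ) / 2 := by ring
      _ ≤ M' * (C₀ * C * θ) / 2 := by linarith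
      _ ≤ Real.pi / 32 := by linarith [hP2]
  have hB3 : ϰ * k * ((5 * C₀ / R ^ 2) * vQ + (C₀ * cN + C₀ * C / 2) * R ^ 3) ≤ Real.pi / 32 * (k * R ^ 3) := by
    have h1 : (5 * C₀ / R ^ 2) * vQ ≤ 10 * C₀ * R ^ 3 := by
      rw [div_mul_eq_mul_div, div_le_iff₀ (pow_pos hR 2)]
      calc 5 * C₀ * vQ ≤ 5 * C₀ * (2 * R ^ 5) := mul_le_mul_of_nonneg_left hvQ (mul_nonneg (by norm_num) hC₀0)
        _ = 10 * C₀ * R ^ 3 * R ^ 2 := by ring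
    have h2 : ϰ * k * ((5 * C₀ / R ^ 2) * vQ + (C₀ * cN + C₀ * C / 2) * R ^ 3) ≤
        ϰ * k * ((10 * C₀ + C₀ * cN + C₀ * C / 2) * R ^ 3) :=
      mul_le_mul_of_nonneg_left (by linarith) hϰk
    have h3 : ϰ * k * ((10 * C₀ + C₀ * cN + C₀ * C / 2) * R ^ 3) ≤ ϰ * D * (k * R ^ 3) := by
      have h := mul_le_mul_of_nonneg_right (mul_le_mul_of_nonneg_left hD' hϰ0.le) hX.le
      calc ϰ * k * ((10 * C₀ + C₀ * cN + C₀ * C / 2) * R ^ 3)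
          = ϰ * (10 * C₀ + C₀ * cN + C₀ * C / 2) * (k * R ^ 3) := by ring
        _ ≤ ϰ * D * (k * R ^ 3) := h
    have h4 := mul_le_mul_of_nonneg_right hP3 hX.le
    linarith
  have hmain : 3 * Real.pi / 32 * (k * R ^ 3) ≤ M * Γ * V * k / R ^ 2 := by
    linarith [hE_br, hQ_br, eE.le, eE.ge, eQ.le, eQ.ge]
  have hmain' : 3 * Real.pi / 32 * R ^ 5 ≤ M' * Γ * V := by
    have h1 : M * Γ * V * k / R ^ 2 ≤ M' * Γ * V * k / R ^ 2 :=
      div_le_div_of_nonneg_right (mul_le_mul_of_nonneg_right (mul_le_mul_of_nonneg_right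
        (mul_le_mul_of_nonneg_right hMM' hΓ0) hV0) hk.le) (sq_nonneg R)
    have h2 := hmain.trans h1
    rw [le_div_iff₀ (pow_pos hR 2)] at h2
    have e1 : 3 * Real.pi / 32 * (k * R ^ 3) * R ^ 2 = (3 * Real.pi / 32 * R ^ 5) * k := by ring
    have e2 : M' * Γ * V * k = (M' * Γ * V) * k := by ring
    rw [e1, e2] at h2
    exact le_of_mul_le_mul_right h2 hk
  rw [hδ, div_mul_eq_mul_div, div_le_iff₀ (by linarith [mul_nonneg hM'0.le hΓ0])]
  have e : V * (M' * Γ + 1) = M' * Γ * V + V := by ring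
  rw [e]; linarith

end Summit.NavierStokesRegularity.NavierStokesRegularity.Theorems.AxisymmetricKatoGlobal.EulerScaling

end
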